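import Mathlib.Analysis.CStarAlgebra.Matrix
import Mathlib.Analysis.SpecialFunctions.Sqrt
import Mathlib.Algebra.Order.BigOperators.Ring.Finset
import Mathlib.Data.Rat.Floor
import Summits.Ventures.CertifiedManyBodySolver.Upper.IntervalReaderSchur
import HarnessLib

/-!
# Ventures/CertifiedManyBodySolver — Upper/IntervalReaderBytes.lean: the integer bookkeeping of the
interval reader and its one floating-point premise (Theorem H1′, part 25)

HONEST FRAMING: first certified bounds; not a superconductivity verdict; every number certified (two
readers) or labelled float.  This file is about A READER'S OWN ARITHMETIC — the integer maps of
`l3core/h1sweep.py`, `bounds.py`, `limb.py` (binary of record `l3core 0.6.9` 5fda02e5cf27520d; the same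
substrate under `l3core-sgf 0.1.10`) — and says nothing about the Hubbard model, a producer, a row, or the
thermodynamic limit.  Source (prose, read against the code): `HOME/sr-mbsolver-ird-2/pages/
THEOREM-H1PRIME-PROOF-NOTE.md` §1 («every operation inside `rd_P(·)` is an EXACT integer operation; `rd_P` is
`v ↦ ⌊(v + 2^(p−1))/2^p⌋`») and §4 («why the integer substrate is exact — the only place floating point
appears»).  Parts 1–24 take as HYPOTHESES the per-step defect bounds (entrywise rounding defect `≤ ε`, whence
`‖D‖₂ ≤ √(#m·#n)·ε` by part 1) and that the rounded products are the exact ones; this part supplies, from the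
code's own maps:
* §A `roundShift v s = ⌊(v + 2^(s−1))/2^s⌋` (`limb.round_shift`, `h1sweep._round_blocks`): defect at most half a
  unit (`two_mul_abs_roundShift_mul_sub_le`); on the grid an exact entry `v·2^(−P−s)` rounded to `2^(−P)·ℤ` moves
  by `≤ 2^(−P−1)` (`roundShift_grid_sub_le`) = LITERALLY the `ε` of part 1's `l2_opNorm_le_of_forall_norm_entry_le`,
  so `roundShift_defect_l2_opNorm_le` yields the code's `rho = χ·2^(−P−1)` / `rho1_one = √(χ_x χ_{x+1})·2^(−P−1)`
  from the bytes' own rounding map;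
* §B `rup r G = ⌈r·2^G⌉/2^G` (`h1sweep._rup`): outward (`le_rup`) and on the grid (`rup_eq_div`);
* §C `isqrtCeil x bits` (`bounds.isqrt_ceil_fraction`): `sqrt_le_isqrtCeil` — the returned rational is `≥ √x`
  (the `sk ≥ √κ`, `SQ[n]`, `rho1_one` roots of `h1_sweep`; the Weinstein / temple roots of part 5);
* §D limbs (`limb.py`, base `2^W`, `W = 20`): `limbMatVal`, `limbMatVal_mul_limbMatVal` (a product of limb stacks is
  the `2^(W(i+j))`-weighted sum of the LIMB-PAIR products — `limb.mul` / `_recombine`), `abs_sum_mul_le` (a partial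
  sum of a limb-pair dot product over `k` terms with entries `≤ B` has modulus `≤ k·B²`), `limb_budget`
  (`k ≤ KMAX_INNER = 8192 ⇒ k·2^40 ≤ 2^53`);
* §E THE ONE FLOATING-POINT PREMISE (A1), EXPLICIT, as a hypothesis on an abstract rounding `rd : ℝ → ℝ`:
  `float64Finite` (the finite binary64 numbers; every integer of modulus `≤ 2^53` is one), `rd_intCast_of_nearest`
  (IEEE form «`rd` is a nearest rounding into `float64Finite` on `|x| ≤ 2^53`» ⇒ «`rd` fixes every integer of
  modulus `≤ 2^53`», the form the proofs use), `EvalTree` (ANY bracketing of a dot product, every node rounded,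
  `fma` nodes allowed), **`EvalTree.rounded_eq_exact_of_int`** (integer leaves `≤ M`, `(#leaves)·M ≤ 2^53` ⇒ the
  rounded evaluation IS the exact one) and **`limbPair_entry_exact(_of_nearest)`**: under (A1) every entry of a
  limb-pair block computed by any float64 GEMM (any summation order, FMA or not) is the exact integer `(L * M) a b`
  when `k·2^(2W) ≤ 2^53`, i.e. `k ≤ KMAX_INNER`.

WHAT THIS LEAVES OUTSIDE THE TREE (unchanged in kind, smaller in extent): (i) that the platform's binary64
`+ / × / fma` conform to IEEE-754 round-to-nearest, i.e. that `hrd` holds for the machine's arithmetic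
(`limb.a1_selfcheck` tests this premise in-job: worst cases + seeded `k = 8192` products), and that the int64
carry / recombination / `round_shift` kernels implement the integer maps named here (bit-for-bit self-tests
`selftest_limb`, `selftest_c_vs_numpy`; int64 overflow excluded by the normal form — not modelled); (ii) the
evaluation of the contractions themselves (kit jobs).  Elementary; Mathlib only (plus part 1).
-/

noncomputable section

open Matrix Finset

namespace Summit.Ventures.CertifiedManyBodySolver.Upper.IntervalReader

/-! ## §A  `round_shift`: nearest rounding by an integer shift -/

/-- `roundShift v s = ⌊(v + 2^(s−1)) / 2^s⌋` for `s ≥ 1` and `roundShift v 0 = v`: E1's `limb.round_shift` /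
`limbc.c round_shift_norm` / `h1sweep._round_blocks` (`(v + half) >> shift` with `half = 1 << (shift − 1)`;
Python's `>>` and Lean's `Int` division by a positive power of two are both FLOOR division).  It takes an exact
integer environment entry at scale `2^(−P−s)` to the nearest point of the grid `2^(−P)·ℤ` (ties upward). -/
def roundShift (v : ℤ) (s : ℕ) : ℤ :=
  if s = 0 then v else (v + 2 ^ (s - 1)) / 2 ^ s

/-- `roundShift v 0 = v` (`_round_blocks`: `if shift == 0: return X`). -/
@[simp] theorem roundShift_zero (v : ℤ) : roundShift v 0 = v := by
  simp [roundShift]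

/-- **Nearest rounding, defect at most half a unit**: `2 · |roundShift v s · 2^s − v| ≤ 2^s` for every `s`
(for `s ≥ 1` this is `|roundShift v s · 2^s − v| ≤ 2^(s−1)`; for `s = 0` both sides are trivial). -/
theorem two_mul_abs_roundShift_mul_sub_le (v : ℤ) (s : ℕ) :
    2 * |roundShift v s * 2 ^ s - v| ≤ 2 ^ s := by
  rcases Nat.eq_zero_or_pos s with hs | hs
  · subst hs; simp
  rw [roundShift, if_neg (Nat.pos_iff_ne_zero.mp hs)]
  have hd : (2 : ℤ) ^ s = 2 * 2 ^ (s - 1) := by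
    rw [← pow_succ', Nat.sub_add_cancel hs]
  have hdpos : (0 : ℤ) < 2 ^ s := by positivity
  have key : (v + 2 ^ (s - 1)) % 2 ^ s + 2 ^ s * ((v + 2 ^ (s - 1)) / 2 ^ s) = v + 2 ^ (s - 1) :=
    Int.emod_add_mul_ediv _ _
  have key' : (v + 2 ^ (s - 1)) / 2 ^ s * 2 ^ s = 2 ^ s * ((v + 2 ^ (s - 1)) / 2 ^ s) := mul_comm _ _
  have hr0 : 0 ≤ (v + 2 ^ (s - 1)) % 2 ^ s := Int.emod_nonneg _ hdpos.ne'
  have hr1 : (v + 2 ^ (s - 1)) % 2 ^ s < 2 ^ s := Int.emod_lt_of_pos _ hdpos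
  have habs : |(v + 2 ^ (s - 1)) / 2 ^ s * 2 ^ s - v| ≤ 2 ^ (s - 1) := by
    rw [abs_le]; constructor <;> linarith
  linarith

/-- `s ≥ 1` form: `|roundShift v s · 2^s − v| ≤ 2^(s−1)`. -/
theorem abs_roundShift_mul_sub_le (v : ℤ) {s : ℕ} (hs : s ≠ 0) :
    |roundShift v s * 2 ^ s - v| ≤ 2 ^ (s - 1) := by
  have h := two_mul_abs_roundShift_mul_sub_le v s
  have hd : (2 : ℤ) ^ s = 2 * 2 ^ (s - 1) := by
    rw [← pow_succ', Nat.sub_add_cancel (Nat.pos_iff_ne_zero.mpr hs)]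
  linarith

/-- **On the reader's grid.**  An exact entry `v · 2^(−(P+s))` (an integer product carrying the scale of the
site tensor, `shift = p_x` or `2 p_x`) is replaced by `roundShift v s · 2^(−P)`; the defect is at most
`2^(−P−1)` — the `ε` that part 1's `l2_opNorm_le_of_forall_norm_entry_le` consumes. -/
theorem roundShift_grid_sub_le (v : ℤ) (s P : ℕ) :
    |(roundShift v s : ℝ) / 2 ^ P - (v : ℝ) / 2 ^ (P + s)| ≤ 1 / 2 ^ (P + 1) := by
  have h := two_mul_abs_roundShift_mul_sub_le v s
  have hR : 2 * |(roundShift v s : ℝ) * 2 ^ s - v| ≤ 2 ^ s := by exact_mod_cast h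
  have hPs : (2 : ℝ) ^ (P + s) = 2 ^ P * 2 ^ s := pow_add _ _ _
  have hpos : (0 : ℝ) < 2 ^ (P + s) := by positivity
  have hre : (roundShift v s : ℝ) / 2 ^ P - (v : ℝ) / 2 ^ (P + s)
      = ((roundShift v s : ℝ) * 2 ^ s - v) / 2 ^ (P + s) := by
    rw [hPs]; field_simp
  calc |(roundShift v s : ℝ) / 2 ^ P - (v : ℝ) / 2 ^ (P + s)|
      = |(roundShift v s : ℝ) * 2 ^ s - v| / 2 ^ (P + s) := by
        rw [hre, abs_div, abs_of_pos hpos]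
    _ ≤ (2 ^ s / 2) / 2 ^ (P + s) := by
        gcongr
        linarith
    _ = 1 / 2 ^ (P + 1) := by
        rw [hPs, pow_succ]; field_simp

section L2

open scoped Matrix.Norms.L2Operator

variable {m n : Type*} [Fintype m] [Fintype n] [DecidableEq n]

/-- **The rounding defect of a block, from the bytes' own map.**  Rounding every entry of an exact integer block
`V` at scale `2^(−(P+s))` to the grid `2^(−P)·ℤ` by `roundShift · s` produces a defect matrix of `L²` operator
norm `≤ √(#m·#n) · 2^(−P−1)` — part 1's `l2_opNorm_le_of_forall_norm_entry_le` with its `ε` DISCHARGED by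
`roundShift_grid_sub_le`.  For the reader's square `χ_{x+1} × χ_{x+1}` environments this is the code's
`rho = χ_{x+1}·2^(−P−1)`; for an intermediate `χ_x × χ_{x+1}` block it is `rho1_one`. -/
theorem roundShift_defect_l2_opNorm_le (V : Matrix m n ℤ) (s P : ℕ) :
    ‖(Matrix.of fun i j => (roundShift (V i j) s : ℝ) / 2 ^ P - (V i j : ℝ) / 2 ^ (P + s) : Matrix m n ℝ)‖
      ≤ Real.sqrt (Fintype.card m * Fintype.card n) * (1 / 2 ^ (P + 1)) :=
  l2_opNorm_le_of_forall_norm_entry_le _ (by positivity) fun i j => by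
    rw [Matrix.of_apply, Real.norm_eq_abs]
    exact roundShift_grid_sub_le (V i j) s P

end L2

/-! ## §B  `_rup`: radii rounded UP to a dyadic grid -/

/-- `rup r G = ⌈r · 2^G⌉ / 2^G`: `h1sweep._rup` («round a nonnegative Fraction UP to the dyadic grid `2^-G`»:
`num = r.numerator << G; q, rem = divmod(num, r.denominator); if rem: q += 1` is the ceiling of `r·2^G`). -/
def rup (r : ℚ) (G : ℕ) : ℚ := (⌈r * 2 ^ G⌉ : ℚ) / 2 ^ G

/-- `_rup` is OUTWARD: `r ≤ rup r G` («sound because radii only grow»). -/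
theorem le_rup (r : ℚ) (G : ℕ) : r ≤ rup r G := by
  unfold rup
  rw [le_div_iff₀ (by positivity)]
  exact Int.le_ceil _

/-- `_rup` lands on the grid: `rup r G = q / 2^G` with `q = ⌈r·2^G⌉ ∈ ℤ`. -/
theorem rup_eq_div (r : ℚ) (G : ℕ) : ∃ q : ℤ, rup r G = q / 2 ^ G := ⟨⌈r * 2 ^ G⌉, rfl⟩

/-! ## §C  `isqrt_ceil_fraction`: square roots rounded UP as rationals -/

/-- `isqrtCeil x bits`: `bounds.isqrt_ceil_fraction` — with `n = x.num · 4^bits`, `d = x.den` and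
`r = ⌈√(n·d)⌉` computed as `isqrt(n·d)` plus one if its square falls short, the result is `r / (d · 2^bits)`
(for `x ≥ 0`; the code asserts `x ≥ 0`, and we read `x.num` through `Int.toNat`). -/
def isqrtCeil (x : ℚ) (bits : ℕ) : ℚ :=
  let n : ℕ := x.num.toNat * 4 ^ bits
  let r₀ : ℕ := Nat.sqrt (n * x.den)
  let r : ℕ := if r₀ * r₀ < n * x.den then r₀ + 1 else r₀
  (r : ℚ) / (x.den * 2 ^ bits)

/-- The integer root the code returns dominates the real root: `√(N) ≤ r` where `r = isqrt N` or `isqrt N + 1`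
according as `(isqrt N)² = N` or `< N`. -/
theorem sqrt_le_isqrt_step (N : ℕ) :
    Real.sqrt N ≤ ((if Nat.sqrt N * Nat.sqrt N < N then Nat.sqrt N + 1 else Nat.sqrt N : ℕ) : ℝ) := by
  split_ifs with h
  · have hlt : (N : ℝ) < ((Nat.sqrt N + 1 : ℕ) : ℝ) ^ 2 := by exact_mod_cast Nat.lt_succ_sqrt' N
    exact (Real.sqrt_le_sqrt hlt.le).trans (Real.sqrt_sq (by positivity)).le
  · have hle : Nat.sqrt N * Nat.sqrt N ≤ N := Nat.sqrt_le N
    have heq : Nat.sqrt N * Nat.sqrt N = N := le_antisymm hle (not_lt.mp h)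
    have : (N : ℝ) = ((Nat.sqrt N : ℕ) : ℝ) ^ 2 := by rw [sq]; exact_mod_cast heq.symm
    rw [this, Real.sqrt_sq (by positivity)]

/-- **`isqrt_ceil_fraction` rounds the square root UP**: `√x ≤ isqrtCeil x bits` for `0 ≤ x`
(`√(num/den) = √(num·4^bits·den) / (den·2^bits) ≤ ⌈√(num·4^bits·den)⌉ / (den·2^bits)`). -/
theorem sqrt_le_isqrtCeil {x : ℚ} (hx : 0 ≤ x) (bits : ℕ) :
    Real.sqrt (x : ℝ) ≤ ((isqrtCeil x bits : ℚ) : ℝ) := by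
  dsimp only [isqrtCeil]
  set n : ℕ := x.num.toNat * 4 ^ bits with hn
  set N : ℕ := n * x.den with hN
  have hnum : (x.num.toNat : ℤ) = x.num := Int.toNat_of_nonneg (Rat.num_nonneg.mpr hx)
  have hD : (0 : ℝ) < (x.den : ℝ) * 2 ^ bits := by
    have : (0 : ℝ) < x.den := by exact_mod_cast x.den_pos
    positivity
  -- `x = N / (den · 2^bits)²`
  have hxR : (x : ℝ) = (N : ℝ) / ((x.den : ℝ) * 2 ^ bits) ^ 2 := by
    have hx' : (x : ℝ) = (x.num : ℝ) / x.den := by exact_mod_cast (Rat.num_div_den x).symm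
    have hnumR : (x.num : ℝ) = (x.num.toNat : ℝ) := by exact_mod_cast hnum.symm
    have h4 : (4 : ℝ) ^ bits = (2 ^ bits) ^ 2 := by rw [sq, ← mul_pow]; norm_num
    rw [hx', hN, hn, hnumR]
    push_cast
    rw [h4]
    field_simp
  have hsq : Real.sqrt (x : ℝ) = Real.sqrt N / ((x.den : ℝ) * 2 ^ bits) := by
    rw [hxR, Real.sqrt_div' _ (by positivity), Real.sqrt_sq hD.le]
  have hstep := sqrt_le_isqrt_step N
  rw [hsq]
  push_cast at hstep ⊢
  rw [div_le_div_iff_of_pos_right hD]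
  refine hstep.trans (le_of_eq ?_)
  split_ifs <;> norm_cast

/-! ## §D  Limbs: normal form, the limb-pair split, the size of the partial sums -/

/-- The limb width of `limb.py`: `W = 20` (base `2^20`). -/
def limbWidth : ℕ := 20

/-- The inner-dimension cap of `limb.py`: `KMAX_INNER = 1 << (53 − 2W) = 8192` (asserted by `limb.mul` / `tmul`). -/
def limbKMax : ℕ := 8192

/-- The value of a limb stack of matrices: `Σ_{i<K} 2^(W·i) • L i` (`limb.py` normal form
`M = sum_{i<K} limb_i * 2^(W i)`, lower limbs in `[0, 2^W)`, top limb signed in `[−2^W, 2^W)`; the identity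
below needs no sign or range condition). -/
def limbMatVal {m n : Type*} {K : ℕ} (L : Fin K → Matrix m n ℤ) : Matrix m n ℤ :=
  ∑ i : Fin K, (2 : ℤ) ^ (limbWidth * (i : ℕ)) • L i

/-- **The limb-pair split** (`limb.mul` / `_recombine`): the product of two limb stacks is the
`2^(W(i+j))`-weighted sum of the `K₁·K₂` LIMB-PAIR products `L i * M j` — each of which the code obtains from ONE
float64 GEMM (§E) and recombines with exact integer carries. -/
theorem limbMatVal_mul_limbMatVal {m k n : Type*} [Fintype k] {K₁ K₂ : ℕ}
    (L : Fin K₁ → Matrix m k ℤ) (M : Fin K₂ → Matrix k n ℤ) :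
    limbMatVal L * limbMatVal M
      = ∑ i : Fin K₁, ∑ j : Fin K₂, (2 : ℤ) ^ (limbWidth * ((i : ℕ) + (j : ℕ))) • (L i * M j) := by
  unfold limbMatVal
  rw [Matrix.sum_mul]
  refine Finset.sum_congr rfl fun i _ => ?_
  rw [Matrix.mul_sum]
  refine Finset.sum_congr rfl fun j _ => ?_
  rw [Matrix.smul_mul, Matrix.mul_smul, smul_smul, ← pow_add, mul_add]

/-- **Size of the partial sums.**  If `|x l|, |y l| ≤ B` then any partial sum `Σ_{l∈s} x l · y l` of a limb-pair
dot product is an integer of modulus `≤ #s · B²` (`limb.py`: «every partial sum is an integer below `k·2^40`»). -/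
theorem abs_sum_mul_le {ι : Type*} (s : Finset ι) (x y : ι → ℤ) {B : ℤ} (hx : ∀ l, |x l| ≤ B)
    (hy : ∀ l, |y l| ≤ B) : |∑ l ∈ s, x l * y l| ≤ s.card * B ^ 2 := by
  have hB : ∀ l, |x l * y l| ≤ B ^ 2 := fun l => by
    rw [abs_mul, sq]
    exact mul_le_mul (hx l) (hy l) (abs_nonneg _) ((abs_nonneg _).trans (hx l))
  calc |∑ l ∈ s, x l * y l| ≤ ∑ l ∈ s, |x l * y l| := Finset.abs_sum_le_sum_abs _ _
    _ ≤ ∑ _l ∈ s, B ^ 2 := Finset.sum_le_sum fun l _ => hB l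
    _ = s.card * B ^ 2 := by rw [Finset.sum_const, nsmul_eq_mul]

/-- **The budget**: with limb entries of modulus `≤ 2^W` (top limbs included) and inner dimension
`k ≤ KMAX_INNER = 8192`, `k · (2^W)² ≤ 2^53` (`limb.py`: «`|sum_{l<k} x_l y_l| <= k 2^40 <= 2^53`»). -/
theorem limb_budget {k : ℕ} (hk : k ≤ limbKMax) : (k : ℤ) * (2 ^ limbWidth) ^ 2 ≤ 2 ^ 53 := by
  have : (k : ℤ) ≤ 8192 := by exact_mod_cast hk
  simp only [limbWidth]
  nlinarith

/-! ## §E  The one floating-point premise (A1), explicit, and the exactness of the limb-pair GEMM -/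

/-- The FINITE binary64 numbers as reals: `m · 2^e` with integers `|m| < 2^53`, `−1074 ≤ e ≤ 971` (this set
is exactly the finite IEEE-754 binary64 values: normal numbers `(2^52 + f)·2^(E−52)`, `E ∈ [−1022, 1023]`, and
subnormals `f·2^(−1074)`, `f < 2^52`). -/
def float64Finite : Set ℝ :=
  {x | ∃ m e : ℤ, |m| < 2 ^ 53 ∧ -1074 ≤ e ∧ e ≤ 971 ∧ x = (m : ℝ) * (2 : ℝ) ^ e}

/-- Every integer of modulus `≤ 2^53` is a finite binary64 number (`|z| < 2^53`: `z·2^0`; `|z| = 2^53`: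
`(±2^52)·2^1`) — in particular every limb (`|limb| ≤ 2^20`) and every partial sum the budget allows. -/
theorem intCast_mem_float64Finite {z : ℤ} (hz : |z| ≤ 2 ^ 53) : (z : ℝ) ∈ float64Finite := by
  rcases hz.lt_or_eq with hlt | heq
  · exact ⟨z, 0, hlt, by norm_num, by norm_num, by simp⟩
  · rcases (abs_eq (by positivity)).mp heq with rfl | rfl
    · exact ⟨2 ^ 52, 1, by norm_num, by norm_num, by norm_num, by norm_num⟩
    · exact ⟨-(2 ^ 52), 1, by norm_num, by norm_num, by norm_num, by norm_num⟩

/-- **(A1), the premise, in IEEE form ⇒ the form the proofs use.**  If `rd : ℝ → ℝ` is a NEAREST ROUNDING into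
the finite binary64 numbers on the range `|x| ≤ 2^53` — `rd x` is never farther from `x` than any finite binary64
number (what IEEE-754 round-to-nearest is for the exact result of `+`, `−`, `×`, `fma` on binary64 operands,
whatever the tie rule; no overflow or underflow can occur at these magnitudes) — then `rd` FIXES every integer of
modulus `≤ 2^53` («products and sums of integers below `2^53` incur no rounding»).  This is a hypothesis about the
MACHINE (`limb.a1_selfcheck` tests it in-job), never an axiom of the tree. -/
theorem rd_intCast_of_nearest {rd : ℝ → ℝ}
    (hrd : ∀ x : ℝ, |x| ≤ 2 ^ 53 → ∀ y ∈ float64Finite, |rd x - x| ≤ |y - x|)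
    {z : ℤ} (hz : |z| ≤ 2 ^ 53) : rd (z : ℝ) = z := by
  have := hrd (z : ℝ) (by exact_mod_cast hz) (z : ℝ) (intCast_mem_float64Finite hz)
  rw [sub_self, abs_zero] at this
  exact sub_eq_zero.mp (abs_eq_zero.mp (le_antisymm this (abs_nonneg _)))

/-- **An evaluation tree** of a sum of leaf values indexed by `ι`: ANY bracketing / summation order a BLAS kernel
may use for a dot product, every node rounded; `fma l t` is a fused multiply-add node `rd (f l + t)` whose
product leaf `f l` is NOT separately rounded.  (Each node returns `rd` of the EXACT result of one operation on
already-rounded operands — the IEEE-754 semantics of a basic operation; the leaf operands, the limbs, are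
integers `≤ 2^20 < 2^53`, converted to binary64 exactly.) -/
inductive EvalTree (ι : Type*) where
  /-- a leaf: the value `f l` (for a dot product, the product `x l · y l`), rounded -/
  | leaf : ι → EvalTree ι
  /-- a rounded addition of two sub-results -/
  | add : EvalTree ι → EvalTree ι → EvalTree ι
  /-- a fused multiply-add: `rd (f l + t)` -/
  | fma : ι → EvalTree ι → EvalTree ι

namespace EvalTree
variable {ι : Type*}

/-- The exact value of the tree on leaf values `f` (in any additive commutative monoid). -/
def exact {R : Type*} [AddCommMonoid R] (f : ι → R) : EvalTree ι → R
  | leaf l => f l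
  | add a b => a.exact f + b.exact f
  | fma l t => f l + t.exact f

/-- The value computed with EVERY node rounded by `rd`. -/
def rounded (rd : ℝ → ℝ) (f : ι → ℝ) : EvalTree ι → ℝ
  | leaf l => rd (f l)
  | add a b => rd (a.rounded rd f + b.rounded rd f)
  | fma l t => rd (f l + t.rounded rd f)

/-- The multiset of leaves the tree reads (with multiplicity). -/
def leaves : EvalTree ι → Multiset ι
  | leaf l => {l}
  | add a b => a.leaves + b.leaves
  | fma l t => {l} + t.leaves

/-- The exact value is the sum of the leaf values read. -/
theorem exact_eq_sum_leaves {R : Type*} [AddCommMonoid R] (f : ι → R) :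
    ∀ t : EvalTree ι, t.exact f = (t.leaves.map f).sum
  | leaf l => by simp [exact, leaves]
  | add a b => by simp [exact, leaves, exact_eq_sum_leaves f a, exact_eq_sum_leaves f b]
  | fma l t => by simp [exact, leaves, exact_eq_sum_leaves f t]

/-- A tree that reads every index exactly once computes (exactly) the full sum `Σ_l f l`. -/
theorem exact_eq_sum {R : Type*} [AddCommMonoid R] [Fintype ι] (f : ι → R) {t : EvalTree ι}
    (ht : t.leaves = Finset.univ.val) : t.exact f = ∑ l, f l := by
  rw [exact_eq_sum_leaves, ht, Finset.sum_eq_multiset_sum]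

/-- **Size of every node**: if `|g l| ≤ M` for all `l` then `|t.exact g| ≤ (#leaves t) · M`. -/
theorem abs_exact_le (g : ι → ℤ) {M : ℤ} (hg : ∀ l, |g l| ≤ M) :
    ∀ t : EvalTree ι, |t.exact g| ≤ (Multiset.card t.leaves : ℤ) * M
  | leaf l => by simpa [exact, leaves] using hg l
  | add a b => by
      simp only [exact, leaves, Multiset.card_add, Nat.cast_add, add_mul]
      exact (abs_add_le _ _).trans (add_le_add (abs_exact_le g hg a) (abs_exact_le g hg b))
  | fma l t => by
      simp only [exact, leaves, Multiset.card_add, Multiset.card_singleton, Nat.cast_add, Nat.cast_one,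
        add_mul, one_mul]
      exact (abs_add_le _ _).trans (add_le_add (hg l) (abs_exact_le g hg t))

/-- **Exactness below `2^53`.**  If `rd` fixes every integer of modulus `≤ 2^53`, a tree whose leaves are
INTEGERS of modulus `≤ M` and whose leaf count satisfies `(#leaves)·M ≤ 2^53` evaluates EXACTLY, whatever its
shape: every node's exact value is an integer of modulus `≤ 2^53` (`abs_exact_le`), hence fixed by `rd` —
induction on the tree («independent of summation order / FMA use»). -/
theorem rounded_eq_exact_of_int {rd : ℝ → ℝ} (hrd : ∀ z : ℤ, |z| ≤ 2 ^ 53 → rd (z : ℝ) = z) (g : ι → ℤ)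
    {M : ℤ} (hM : 0 ≤ M) (hg : ∀ l, |g l| ≤ M) :
    ∀ t : EvalTree ι, (Multiset.card t.leaves : ℤ) * M ≤ 2 ^ 53 →
      t.rounded rd (fun l => (g l : ℝ)) = ((t.exact g : ℤ) : ℝ)
  | leaf l, ht => by
      have hM' : M ≤ 2 ^ 53 := by simpa [leaves] using ht
      simp only [rounded, exact]
      exact hrd _ ((hg l).trans hM')
  | add a b, ht => by
      have hca : (Multiset.card a.leaves : ℤ) * M ≤ 2 ^ 53 :=
        le_trans (mul_le_mul_of_nonneg_right (by simp [leaves]) hM) ht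
      have hcb : (Multiset.card b.leaves : ℤ) * M ≤ 2 ^ 53 :=
        le_trans (mul_le_mul_of_nonneg_right (by simp [leaves]) hM) ht
      simp only [rounded, exact, rounded_eq_exact_of_int hrd g hM hg a hca,
        rounded_eq_exact_of_int hrd g hM hg b hcb, ← Int.cast_add]
      exact hrd _ ((abs_exact_le g hg (add a b)).trans ht)
  | fma l t, ht => by
      have hct : (Multiset.card t.leaves : ℤ) * M ≤ 2 ^ 53 :=
        le_trans (mul_le_mul_of_nonneg_right (by simp [leaves]) hM) ht
      simp only [rounded, exact, rounded_eq_exact_of_int hrd g hM hg t hct, ← Int.cast_add]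
      exact hrd _ ((abs_exact_le g hg (fma l t)).trans ht)

end EvalTree
/-- **Limb-pair GEMM exact below the budget** (`limb.py` module docstring; proof note §4).  If `rd` fixes every
integer of modulus `≤ 2^53`, then for limb blocks `L` (`m × k`) and `M` (`k × n`) with entries of modulus `≤ 2^W`
and `#k · (2^W)² ≤ 2^53`, EVERY entry of `L * M` computed by a float64 GEMM — an arbitrary evaluation tree `T`
reading each inner index once (any blocking / summation order / FMA use) — equals the exact integer
`(L * M) a b`.  The hypotheses on `L`, `M`, `k` are the code's assertions `|limb| ≤ 2^20` (normal form) and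
`k ≤ KMAX_INNER` (`limb_budget`). -/
theorem limbPair_entry_exact {rd : ℝ → ℝ} (hrd : ∀ z : ℤ, |z| ≤ 2 ^ 53 → rd (z : ℝ) = z)
    {m n k : Type*} [Fintype k] (L : Matrix m k ℤ) (M : Matrix k n ℤ)
    (hL : ∀ a l, |L a l| ≤ 2 ^ limbWidth) (hM : ∀ l b, |M l b| ≤ 2 ^ limbWidth)
    (hk : (Fintype.card k : ℤ) * (2 ^ limbWidth) ^ 2 ≤ 2 ^ 53)
    (a : m) (b : n) (T : EvalTree k) (hT : T.leaves = Finset.univ.val) :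
    T.rounded rd (fun l => ((L a l * M l b : ℤ) : ℝ)) = (((L * M) a b : ℤ) : ℝ) := by
  have hprod : ∀ l, |L a l * M l b| ≤ (2 ^ limbWidth) ^ 2 := fun l => by
    rw [abs_mul, sq]
    exact mul_le_mul (hL a l) (hM l b) (abs_nonneg _) ((abs_nonneg _).trans (hL a l))
  have hcard : (Multiset.card T.leaves : ℤ) * (2 ^ limbWidth) ^ 2 ≤ 2 ^ 53 := by
    rw [hT]; simpa using hk
  have key := EvalTree.rounded_eq_exact_of_int hrd (fun l => L a l * M l b) (by positivity) hprod T hcard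
  rw [EvalTree.exact_eq_sum _ hT, ← Matrix.mul_apply] at key
  exact key

/-- **(A1) ⇒ the limb-pair GEMM is exact**, the code's form: IEEE nearest rounding on `|x| ≤ 2^53` and inner
dimension `≤ KMAX_INNER = 8192` (`limb.mul`: `assert k <= KMAX_INNER`). -/
theorem limbPair_entry_exact_of_nearest {rd : ℝ → ℝ}
    (hrd : ∀ x : ℝ, |x| ≤ 2 ^ 53 → ∀ y ∈ float64Finite, |rd x - x| ≤ |y - x|)
    {m n k : Type*} [Fintype k] (L : Matrix m k ℤ) (M : Matrix k n ℤ)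
    (hL : ∀ a l, |L a l| ≤ 2 ^ limbWidth) (hM : ∀ l b, |M l b| ≤ 2 ^ limbWidth)
    (hk : Fintype.card k ≤ limbKMax) (a : m) (b : n) (T : EvalTree k) (hT : T.leaves = Finset.univ.val) :
    T.rounded rd (fun l => ((L a l * M l b : ℤ) : ℝ)) = (((L * M) a b : ℤ) : ℝ) :=
  limbPair_entry_exact (fun _ hz => rd_intCast_of_nearest hrd hz) L M hL hM (limb_budget hk) a b T hT

end Summit.Ventures.CertifiedManyBodySolver.Upper.IntervalReader

end
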